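import Mathlib
import Summits.Ventures.PercRepro2.Defs
import Summits.Ventures.PercRepro2.Harris
import Summits.Ventures.PercRepro2.Graph
import Summits.Ventures.PercRepro2.Events
import Summits.Ventures.PercRepro2.Induced
import Summits.Ventures.PercRepro2.SameClusterAvoid
import Summits.Ventures.PercRepro2.BHKAvoid
import Summits.Ventures.PercRepro2.CCTRootEdge
import Summits.Ventures.PercRepro2.CCTAvoidedEdge
import Summits.Ventures.PercRepro2.OneRootDropMono
import Summits.Ventures.PercRepro2.TwoRootLeanMono
import Summits.Ventures.PercRepro2.PrefMonoGlue

/-!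
# The status classes of the `e`-closed instance and the glued masses (`PrefMono`, part 2)
(blind cell PercRepro2, mine-c g29; `conjectures/MINE-C.md` §38.4)

The seven primitive class events `Z00 Z01 Z02 Z1n Z12 Z2n Z21` of `(s_v, s_y)`, the closed masses
`P₀(Q), P₀(E), P₀(N), P₀(A)` as class sums (`Q_eq_E_add_N`, `E_eq`, `N_eq_M2_add_A`, `M2_eq`, `A_eq`) and
the glued masses `P₁(Q), P₁(E), P₁(N), P₁(A)` as class sums (`Q_one`, `E_one`, `N_one`, `A_one`): gluing
`v ~ y` kills exactly the two opposite classes and merges the rest.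
-/

namespace Summit.Ventures.PercRepro2

namespace PrefMono

variable {V : Type*} {E : Type*} [Fintype V] [DecidableEq V] [Fintype E] [DecidableEq E]
  {R : Type*} [Field R] [LinearOrder R] [IsStrictOrderedRing R]

section Masses

variable (p : E → R) (ends : E → Sym2 V) (a₁ a₂ : V) {e : E} {v y : V}

/-! The seven primitive class events of the `e`-closed instance (the `(1,0)+(1,1)` and
`(2,0)+(2,2)` classes are kept together). -/

/-- `(0,0)`: `v, y ∉ C₁ ∪ C₂`. -/
def Z00 (v y : V) : Set (Config E) :=
  AEvent ends a₁ a₂ v ∩ (connEvent ends a₁ y)ᶜ ∩ (connEvent ends a₂ y)ᶜ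
/-- `(0,1)`: `v ∉ C₁ ∪ C₂`, `y ∈ C₁`. -/
def Z01 (v y : V) : Set (Config E) := AEvent ends a₁ a₂ v ∩ connEvent ends a₁ y
/-- `(0,2)`: `v ∉ C₁ ∪ C₂`, `y ∈ C₂`. -/
def Z02 (v y : V) : Set (Config E) := AEvent ends a₁ a₂ v ∩ connEvent ends a₂ y
/-- `(1,0) ∪ (1,1)`: `v ∈ C₁`, `y ∉ C₂`. -/
def Z1n (v y : V) : Set (Config E) := EEvent ends a₁ a₂ v ∩ (connEvent ends a₂ y)ᶜ
/-- `(1,2)`: `v ∈ C₁`, `y ∈ C₂` (opposite). -/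
def Z12 (v y : V) : Set (Config E) := EEvent ends a₁ a₂ v ∩ connEvent ends a₂ y
/-- `(2,0) ∪ (2,2)`: `v ∈ C₂`, `y ∉ C₁`. -/
def Z2n (v y : V) : Set (Config E) :=
  TwoRootLean.NEvent ends a₁ a₂ v ∩ connEvent ends a₂ v ∩ (connEvent ends a₁ y)ᶜ
/-- `(2,1)`: `v ∈ C₂`, `y ∈ C₁` (opposite). -/
def Z21 (v y : V) : Set (Config E) :=
  TwoRootLean.NEvent ends a₁ a₂ v ∩ connEvent ends a₂ v ∩ connEvent ends a₁ y

variable {ends a₁ a₂}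

omit [Fintype V] [Fintype E] [DecidableEq E] in
/-- Membership in the class `(0,0)`. -/
lemma mem_Z00 {ω : Config E} : ω ∈ Z00 ends a₁ a₂ v y ↔
    ω ∈ QEvent ends a₁ a₂ ∧ ¬ Conn ends ω a₁ v ∧ ¬ Conn ends ω a₂ v ∧
      ¬ Conn ends ω a₁ y ∧ ¬ Conn ends ω a₂ y := by
  simp only [Z00, Set.mem_inter_iff, Set.mem_compl_iff, mem_connEvent, mem_A_iff, and_assoc]

omit [Fintype V] [Fintype E] [DecidableEq E] in
/-- Membership in the class `(0,1)`. -/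
lemma mem_Z01 {ω : Config E} : ω ∈ Z01 ends a₁ a₂ v y ↔
    ω ∈ QEvent ends a₁ a₂ ∧ ¬ Conn ends ω a₁ v ∧ ¬ Conn ends ω a₂ v ∧ Conn ends ω a₁ y := by
  simp only [Z01, Set.mem_inter_iff, mem_connEvent, mem_A_iff, and_assoc]

omit [Fintype V] [Fintype E] [DecidableEq E] in
/-- Membership in the class `(0,2)`. -/
lemma mem_Z02 {ω : Config E} : ω ∈ Z02 ends a₁ a₂ v y ↔
    ω ∈ QEvent ends a₁ a₂ ∧ ¬ Conn ends ω a₁ v ∧ ¬ Conn ends ω a₂ v ∧ Conn ends ω a₂ y := by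
  simp only [Z02, Set.mem_inter_iff, mem_connEvent, mem_A_iff, and_assoc]

omit [Fintype V] [DecidableEq V] [Fintype E] [DecidableEq E] in
/-- Membership in the class `(1,0) ∪ (1,1)`. -/
lemma mem_Z1n {ω : Config E} : ω ∈ Z1n ends a₁ a₂ v y ↔
    ω ∈ QEvent ends a₁ a₂ ∧ Conn ends ω a₁ v ∧ ¬ Conn ends ω a₂ y := by
  simp only [Z1n, Set.mem_inter_iff, Set.mem_compl_iff, mem_connEvent, mem_E_iff, and_assoc]

omit [Fintype V] [DecidableEq V] [Fintype E] [DecidableEq E] in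
/-- Membership in the class `(1,2)`. -/
lemma mem_Z12 {ω : Config E} : ω ∈ Z12 ends a₁ a₂ v y ↔
    ω ∈ QEvent ends a₁ a₂ ∧ Conn ends ω a₁ v ∧ Conn ends ω a₂ y := by
  simp only [Z12, Set.mem_inter_iff, mem_connEvent, mem_E_iff, and_assoc]

omit [Fintype V] [Fintype E] [DecidableEq E] in
/-- Membership in the class `(2,0) ∪ (2,2)`. -/
lemma mem_Z2n {ω : Config E} : ω ∈ Z2n ends a₁ a₂ v y ↔
    ω ∈ QEvent ends a₁ a₂ ∧ ¬ Conn ends ω a₁ v ∧ Conn ends ω a₂ v ∧ ¬ Conn ends ω a₁ y := by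
  simp only [Z2n, Set.mem_inter_iff, Set.mem_compl_iff, mem_connEvent, mem_N_iff, and_assoc]

omit [Fintype V] [Fintype E] [DecidableEq E] in
/-- Membership in the class `(2,1)`. -/
lemma mem_Z21 {ω : Config E} : ω ∈ Z21 ends a₁ a₂ v y ↔
    ω ∈ QEvent ends a₁ a₂ ∧ ¬ Conn ends ω a₁ v ∧ Conn ends ω a₂ v ∧ Conn ends ω a₁ y := by
  simp only [Z21, Set.mem_inter_iff, mem_connEvent, mem_N_iff, and_assoc]

variable (ends a₁ a₂)

omit [LinearOrder R] [IsStrictOrderedRing R] in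
/-- Splitting along an event: `P(X) = P(X ∩ Y) + P(X ∩ Yᶜ)`. -/
lemma split (X Y : Set (Config E)) : prob p X = prob p (X ∩ Y) + prob p (X ∩ Yᶜ) :=
  (prob_inter_add_prob_inter_compl p X Y).symm

/-! ### The closed masses in class terms -/

omit [Fintype V] [DecidableEq V] [LinearOrder R] [IsStrictOrderedRing R] in
/-- `P(E) = c₁ₙ + c₁₂` (split `E` by `y ∈ C₂`). -/
lemma E_eq (v y : V) : prob p (EEvent ends a₁ a₂ v) = prob p (Z1n ends a₁ a₂ v y) +
    prob p (Z12 ends a₁ a₂ v y) := by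
  rw [split p (EEvent ends a₁ a₂ v) (connEvent ends a₂ y), add_comm]; rfl

omit [Fintype V] [LinearOrder R] [IsStrictOrderedRing R] in
/-- `P(Q) = P(E) + P(N)` (split `Q` by `v ∈ C₁`). -/
lemma Q_eq_E_add_N (v : V) : prob p (QEvent ends a₁ a₂) =
    prob p (EEvent ends a₁ a₂ v) + prob p (TwoRootLean.NEvent ends a₁ a₂ v) := by
  have h : QEvent ends a₁ a₂ ∩ (connEvent ends a₁ v)ᶜ = TwoRootLean.NEvent ends a₁ a₂ v := by
    ext ω
    simp only [Set.mem_inter_iff, Set.mem_compl_iff, mem_connEvent, mem_N_iff]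
  rw [split p (QEvent ends a₁ a₂) (connEvent ends a₁ v), h]; rfl

omit [Fintype V] [LinearOrder R] [IsStrictOrderedRing R] in
/-- `P(N) = P(N ∩ {v ∈ C₂}) + P(A)` (split `N` by `v ∈ C₂`). -/
lemma N_eq_M2_add_A (v : V) : prob p (TwoRootLean.NEvent ends a₁ a₂ v) =
    prob p (TwoRootLean.NEvent ends a₁ a₂ v ∩ connEvent ends a₂ v) +
      prob p (AEvent ends a₁ a₂ v) := by
  have h : TwoRootLean.NEvent ends a₁ a₂ v ∩ (connEvent ends a₂ v)ᶜ = AEvent ends a₁ a₂ v := by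
    ext ω
    simp only [Set.mem_inter_iff, Set.mem_compl_iff, mem_connEvent, mem_A_iff, mem_N_iff,
      and_assoc]
  rw [split p (TwoRootLean.NEvent ends a₁ a₂ v) (connEvent ends a₂ v), h]

omit [Fintype V] [LinearOrder R] [IsStrictOrderedRing R] in
/-- `P(N ∩ {v ∈ C₂}) = c₂₁ + c₂ₙ` (split by `y ∈ C₁`). -/
lemma M2_eq (v y : V) : prob p (TwoRootLean.NEvent ends a₁ a₂ v ∩ connEvent ends a₂ v) =
    prob p (Z21 ends a₁ a₂ v y) + prob p (Z2n ends a₁ a₂ v y) := by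
  rw [split p _ (connEvent ends a₁ y)]; rfl

omit [Fintype V] [LinearOrder R] [IsStrictOrderedRing R] in
/-- `P(A) = c₀₁ + c₀₂ + c₀₀` (split `A` by `y`'s side; under `Q` the sides are exclusive). -/
lemma A_eq (v y : V) : prob p (AEvent ends a₁ a₂ v) = prob p (Z01 ends a₁ a₂ v y) +
    prob p (Z02 ends a₁ a₂ v y) + prob p (Z00 ends a₁ a₂ v y) := by
  have h : AEvent ends a₁ a₂ v ∩ (connEvent ends a₁ y)ᶜ ∩ connEvent ends a₂ y =
      Z02 ends a₁ a₂ v y := by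
    ext ω
    rw [mem_Z02]
    simp only [Set.mem_inter_iff, Set.mem_compl_iff, mem_connEvent, mem_A_iff]
    constructor
    · rintro ⟨⟨⟨hQ, h1, h2⟩, _⟩, h⟩; exact ⟨hQ, h1, h2, h⟩
    · rintro ⟨hQ, h1, h2, h⟩; exact ⟨⟨⟨hQ, h1, h2⟩, not_conn₁_of_conn₂ hQ h⟩, h⟩
  rw [split p (AEvent ends a₁ a₂ v) (connEvent ends a₁ y),
    split p (AEvent ends a₁ a₂ v ∩ (connEvent ends a₁ y)ᶜ) (connEvent ends a₂ y), ← add_assoc, h]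
  rfl

/-! ### The glued masses in class terms -/

/-- The non-opposite part of `Q` (the `e`-closed instance), as a set. -/
def QOpp (v y : V) : Set (Config E) :=
  QEvent ends a₁ a₂ ∩ (connEvent ends a₁ v ∩ connEvent ends a₂ y)ᶜ ∩
    (connEvent ends a₂ v ∩ connEvent ends a₁ y)ᶜ

variable {ends a₁ a₂}

omit [Fintype V] [DecidableEq V] [Fintype E] [DecidableEq E] in
/-- Membership in the non-opposite part of `Q`. -/
lemma mem_QOpp {ω : Config E} : ω ∈ QOpp ends a₁ a₂ v y ↔
    ω ∈ QEvent ends a₁ a₂ ∧ ¬ (Conn ends ω a₁ v ∧ Conn ends ω a₂ y) ∧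
      ¬ (Conn ends ω a₂ v ∧ Conn ends ω a₁ y) := by
  simp only [QOpp, Set.mem_inter_iff, Set.mem_compl_iff, mem_connEvent, and_assoc]

variable (ends a₁ a₂)

omit [Fintype V] [DecidableEq V] [Fintype E] [DecidableEq E] in
/-- The non-opposite part of `Q` with `v ∈ C₁` is the class `(1,0) ∪ (1,1)`. -/
lemma QOpp_inter_E : QOpp ends a₁ a₂ v y ∩ connEvent ends a₁ v = Z1n ends a₁ a₂ v y := by
  ext ω
  rw [Set.mem_inter_iff, mem_QOpp, mem_Z1n, mem_connEvent]
  constructor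
  · rintro ⟨⟨hQ, h12, _⟩, hv⟩; exact ⟨hQ, hv, fun hy => h12 ⟨hv, hy⟩⟩
  · rintro ⟨hQ, hv, hy⟩
    exact ⟨⟨hQ, fun h => hy h.2, fun h => not_conn₂_of_conn₁ hQ hv h.1⟩, hv⟩

omit [Fintype V] [Fintype E] [DecidableEq E] in
/-- The non-opposite part of `Q` with `v ∈ C₂` is the class `(2,0) ∪ (2,2)`. -/
lemma QOpp_inter_N_inter_M : QOpp ends a₁ a₂ v y ∩ (connEvent ends a₁ v)ᶜ ∩ connEvent ends a₂ v =
    Z2n ends a₁ a₂ v y := by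
  ext ω
  rw [Set.mem_inter_iff, Set.mem_inter_iff, mem_QOpp, mem_Z2n, Set.mem_compl_iff, mem_connEvent,
    mem_connEvent]
  constructor
  · rintro ⟨⟨⟨hQ, _, h21⟩, hv1⟩, hv2⟩; exact ⟨hQ, hv1, hv2, fun hy => h21 ⟨hv2, hy⟩⟩
  · rintro ⟨hQ, hv1, hv2, hy⟩
    exact ⟨⟨⟨hQ, fun h => hv1 h.1, fun h => hy h.2⟩, hv1⟩, hv2⟩

omit [Fintype V] [Fintype E] [DecidableEq E] in
/-- The non-opposite part of `Q` with `v ∉ C₁ ∪ C₂` is `A`. -/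
lemma QOpp_inter_N_inter_A : QOpp ends a₁ a₂ v y ∩ (connEvent ends a₁ v)ᶜ ∩ (connEvent ends a₂ v)ᶜ =
    AEvent ends a₁ a₂ v := by
  ext ω
  rw [Set.mem_inter_iff, Set.mem_inter_iff, mem_QOpp, mem_A_iff, Set.mem_compl_iff,
    Set.mem_compl_iff, mem_connEvent, mem_connEvent]
  constructor
  · rintro ⟨⟨⟨hQ, _, _⟩, hv1⟩, hv2⟩; exact ⟨hQ, hv1, hv2⟩
  · rintro ⟨hQ, hv1, hv2⟩
    exact ⟨⟨⟨hQ, fun h => hv1 h.1, fun h => hv2 h.1⟩, hv1⟩, hv2⟩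

omit [LinearOrder R] [IsStrictOrderedRing R] in
/-- `P₁(Q) = c₀₀ + c₀₁ + c₀₂ + c₁ₙ + c₂ₙ`: gluing `v ~ y` keeps exactly the non-opposite classes. -/
lemma Q_one (hends : ends e = s(v, y)) :
    prob (Function.update p e 1) (QEvent ends a₁ a₂) =
      prob (Function.update p e 0) (Z00 ends a₁ a₂ v y) +
      prob (Function.update p e 0) (Z01 ends a₁ a₂ v y) +
      prob (Function.update p e 0) (Z02 ends a₁ a₂ v y) +
      prob (Function.update p e 0) (Z1n ends a₁ a₂ v y) +
      prob (Function.update p e 0) (Z2n ends a₁ a₂ v y) := by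
  have h1 : prob (Function.update p e 1) (QEvent ends a₁ a₂) =
      prob (Function.update p e 0) (QOpp ends a₁ a₂ v y) := by
    rw [CCT.prob_update_one_eq, CCT.prob_update_zero_eq]
    congr 1
    ext ω
    rw [Set.mem_setOf_eq, Set.mem_setOf_eq, mem_QOpp]
    exact update_true_mem_Q_iff a₁ a₂ hends ω
  rw [h1, split (Function.update p e 0) (QOpp ends a₁ a₂ v y) (connEvent ends a₁ v),
    QOpp_inter_E, split (Function.update p e 0) (QOpp ends a₁ a₂ v y ∩ (connEvent ends a₁ v)ᶜ)
      (connEvent ends a₂ v), QOpp_inter_N_inter_M, QOpp_inter_N_inter_A,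
    A_eq (Function.update p e 0) ends a₁ a₂ v y]
  ring

omit [LinearOrder R] [IsStrictOrderedRing R] in
/-- `P₁(E) = c₀₁ + c₁ₙ`: after the gluing `v ∈ C₁` iff `v` or `y` was, off the opposite classes. -/
lemma E_one (hends : ends e = s(v, y)) :
    prob (Function.update p e 1) (EEvent ends a₁ a₂ v) =
      prob (Function.update p e 0) (Z01 ends a₁ a₂ v y) +
      prob (Function.update p e 0) (Z1n ends a₁ a₂ v y) := by
  have h1 : prob (Function.update p e 1) (EEvent ends a₁ a₂ v) =
      prob (Function.update p e 0)
        (QOpp ends a₁ a₂ v y ∩ (connEvent ends a₁ v ∪ connEvent ends a₁ y)) := by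
    rw [CCT.prob_update_one_eq, CCT.prob_update_zero_eq]
    congr 1
    ext ω
    rw [Set.mem_setOf_eq, Set.mem_setOf_eq, Set.mem_inter_iff, mem_QOpp, Set.mem_union,
      mem_connEvent, mem_connEvent, update_true_mem_E_iff a₁ a₂ hends ω]
    constructor
    · rintro ⟨hQ, h12, h21, h⟩; exact ⟨⟨hQ, h12, h21⟩, h⟩
    · rintro ⟨⟨hQ, h12, h21⟩, h⟩; exact ⟨hQ, h12, h21, h⟩
  have hE : QOpp ends a₁ a₂ v y ∩ (connEvent ends a₁ v ∪ connEvent ends a₁ y) ∩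
      connEvent ends a₁ v = Z1n ends a₁ a₂ v y := by
    ext ω
    rw [Set.mem_inter_iff, Set.mem_inter_iff, mem_QOpp, mem_Z1n, Set.mem_union, mem_connEvent,
      mem_connEvent]
    constructor
    · rintro ⟨⟨⟨hQ, h12, _⟩, _⟩, hv⟩; exact ⟨hQ, hv, fun hy => h12 ⟨hv, hy⟩⟩
    · rintro ⟨hQ, hv, hy⟩
      exact ⟨⟨⟨hQ, fun h => hy h.2, fun h => not_conn₂_of_conn₁ hQ hv h.1⟩, Or.inl hv⟩, hv⟩
  have hA : QOpp ends a₁ a₂ v y ∩ (connEvent ends a₁ v ∪ connEvent ends a₁ y) ∩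
      (connEvent ends a₁ v)ᶜ = Z01 ends a₁ a₂ v y := by
    ext ω
    rw [Set.mem_inter_iff, Set.mem_inter_iff, mem_QOpp, mem_Z01, Set.mem_union,
      Set.mem_compl_iff, mem_connEvent, mem_connEvent]
    constructor
    · rintro ⟨⟨⟨hQ, _, h21⟩, hvy⟩, hv⟩
      have hy : Conn ends ω a₁ y := by
        rcases hvy with h | h
        · exact (hv h).elim
        · exact h
      exact ⟨hQ, hv, fun h2v => h21 ⟨h2v, hy⟩, hy⟩
    · rintro ⟨hQ, hv, hv2, hy⟩
      exact ⟨⟨⟨hQ, fun h => hv h.1, fun h => hv2 h.1⟩, Or.inr hy⟩, hv⟩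
  rw [h1, split (Function.update p e 0) _ (connEvent ends a₁ v), hE, hA, add_comm]

omit [Fintype V] [LinearOrder R] [IsStrictOrderedRing R] in
/-- `P₁(N) = c₀₀ + c₀₂ + c₂ₙ`: after the gluing `v ∉ C₁` iff neither `v` nor `y` was in `C₁`. -/
lemma N_one (hends : ends e = s(v, y)) :
    prob (Function.update p e 1) (TwoRootLean.NEvent ends a₁ a₂ v) =
      prob (Function.update p e 0) (Z00 ends a₁ a₂ v y) +
      prob (Function.update p e 0) (Z02 ends a₁ a₂ v y) +
      prob (Function.update p e 0) (Z2n ends a₁ a₂ v y) := by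
  have hM : TwoRootLean.NEvent ends a₁ a₂ v ∩ (connEvent ends a₁ y)ᶜ ∩ connEvent ends a₂ v =
      Z2n ends a₁ a₂ v y := by
    ext ω
    rw [Set.mem_inter_iff, Set.mem_inter_iff, mem_N_iff, mem_Z2n, Set.mem_compl_iff,
      mem_connEvent, mem_connEvent]
    constructor
    · rintro ⟨⟨⟨hQ, hv⟩, hy⟩, hv2⟩; exact ⟨hQ, hv, hv2, hy⟩
    · rintro ⟨hQ, hv, hv2, hy⟩; exact ⟨⟨⟨hQ, hv⟩, hy⟩, hv2⟩
  have hA2 : TwoRootLean.NEvent ends a₁ a₂ v ∩ (connEvent ends a₁ y)ᶜ ∩ (connEvent ends a₂ v)ᶜ ∩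
      connEvent ends a₂ y = Z02 ends a₁ a₂ v y := by
    ext ω
    rw [Set.mem_inter_iff, Set.mem_inter_iff, Set.mem_inter_iff, mem_N_iff, mem_Z02,
      Set.mem_compl_iff, Set.mem_compl_iff, mem_connEvent, mem_connEvent, mem_connEvent]
    constructor
    · rintro ⟨⟨⟨⟨hQ, hv⟩, _⟩, hv2⟩, hy⟩; exact ⟨hQ, hv, hv2, hy⟩
    · rintro ⟨hQ, hv, hv2, hy⟩; exact ⟨⟨⟨⟨hQ, hv⟩, not_conn₁_of_conn₂ hQ hy⟩, hv2⟩, hy⟩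
  have hA0 : TwoRootLean.NEvent ends a₁ a₂ v ∩ (connEvent ends a₁ y)ᶜ ∩ (connEvent ends a₂ v)ᶜ ∩
      (connEvent ends a₂ y)ᶜ = Z00 ends a₁ a₂ v y := by
    ext ω
    rw [Set.mem_inter_iff, Set.mem_inter_iff, Set.mem_inter_iff, mem_N_iff, mem_Z00,
      Set.mem_compl_iff, Set.mem_compl_iff, Set.mem_compl_iff, mem_connEvent, mem_connEvent,
      mem_connEvent]
    constructor
    · rintro ⟨⟨⟨⟨hQ, hv⟩, hy1⟩, hv2⟩, hy2⟩; exact ⟨hQ, hv, hv2, hy1, hy2⟩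
    · rintro ⟨hQ, hv, hv2, hy1, hy2⟩; exact ⟨⟨⟨⟨hQ, hv⟩, hy1⟩, hv2⟩, hy2⟩
  rw [TwoRootLean.prob_one_N p hends a₁ a₂, TwoRootLean.avoid_eq_compl,
    split (Function.update p e 0) _ (connEvent ends a₂ v), hM,
    split (Function.update p e 0) (TwoRootLean.NEvent ends a₁ a₂ v ∩ (connEvent ends a₁ y)ᶜ ∩
      (connEvent ends a₂ v)ᶜ) (connEvent ends a₂ y), hA2, hA0]
  ring

omit [LinearOrder R] [IsStrictOrderedRing R] in
/-- `P₁(A) = c₀₀`: after the gluing `v` is free of both roots iff `v` and `y` both were. -/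
lemma A_one (hends : ends e = s(v, y)) :
    prob (Function.update p e 1) (AEvent ends a₁ a₂ v) =
      prob (Function.update p e 0) (Z00 ends a₁ a₂ v y) := by
  rw [CCT.prob_update_one_eq, CCT.prob_update_zero_eq]
  congr 1
  ext ω
  rw [Set.mem_setOf_eq, Set.mem_setOf_eq, mem_Z00, update_true_mem_A_iff a₁ a₂ hends ω, mem_A_iff]
  tauto

end Masses

end PrefMono

end Summit.Ventures.PercRepro2
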